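import Summits.Schanuel.Schanuel.Theorems.ZilberEacExplosionRegion
import Summits.Schanuel.Schanuel.Theorems.ZilberEacExplosionStep
import Summits.Schanuel.Schanuel.Theorems.ZilberEacExplosionRoot
import HarnessLib

/-!
# The exp–exp balance in several variables, V: existence near every line of the family

Zilber's Exponential-Algebraic Closedness, case ladder (host summit Schanuel, cell `pub-schanuel`,
seat 2, gen 10).  **`exists_solutions_nearLine`.**  `g, Aⱼ ∈ ℂ[x₀..x_s]`, `fⱼ ∈ ℂ[u] ∖ 0`,
`eⱼ = 1 + deg fⱼ`, `e^{Λⱼ} = lc fⱼ`, slopes `λⱼ = e_{j+1}/e₀`, integer offsets `m`, line offsets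
`νⱼ = λⱼ(2πi m₀ - Λ₀) - (2πi m_{j+1} - Λ_{j+1})`, restriction `p(z) = g(z, λz + ν)` of degree `≥ 2`:
there are solutions `x⁽ⁱ⁾` of `e^{xⱼ} = Aⱼ(x) + e^{g(x)} fⱼ(e^{g(x)})` (`j = 0..s`) with
`‖x⁽ⁱ⁾₀‖ → ∞`, `‖x⁽ⁱ⁾ - ℓ_ν(x⁽ⁱ⁾₀)‖ ≤ ‖x⁽ⁱ⁾₀‖^{-N}`, `e^{Re g(x⁽ⁱ⁾)} ≥ ‖x⁽ⁱ⁾₀‖^{N}` (all `N`,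
eventually) — the solution supply of THEOREM K (`unprojectedDense_polyFibredGraph_of_nearLine`).
Mechanism: `kⱼ = σ eⱼ i + mⱼ` (escaping sign `σ`), root `z₀` of `e₀p(z) - z = V₀`
(`Re z₀ ≍ ‖z₀‖ → ∞`), `η`-scale `δ = e^{-κ r/2}`, perturbation level `θ = εδ/(4(1+‖λ‖))`; the
hypotheses of `exists_solution_nearLine_step` hold for large `i` (`ZilberEacExplosionRegion`).
HONEST FRAMING: existence for explicit members of the OPEN cell `EC(3,2)` (`EC(s+2,s+1)`);
`s = 0` is gen 8's one-variable balance; NOT Schanuel's conjecture; EAC ⇏ SC.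
-/

noncomputable section

open Complex MvPolynomial Filter Topology Metric
open Literature.NumberTheory.Transcendental Literature.ModelTheory.Zilber

set_option linter.dupNamespace false

namespace Summit.Schanuel.Schanuel.Theorems

section Existence

variable {s : ℕ} (g : MvPolynomial (Fin (s + 1)) ℂ) (A : Fin (s + 1) → MvPolynomial (Fin (s + 1)) ℂ)
  (f : Fin (s + 1) → Polynomial ℂ)

set_option maxHeartbeats 400000 in
/-- **THEOREM (existence near every line of the family).**  See the module docstring. (new)
[cite: MantovaMasser2023, §1 p.5 (the open case dim π(V) = 2 in ℂ³×ℂˣ³)] -/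
theorem exists_solutions_nearLine (hf : ∀ j, f j ≠ 0) (Λ : Fin (s + 1) → ℂ) (hΛ : ∀ j, exp (Λ j) = (f j).leadingCoeff)
    (lam : Fin s → ℂ)
    (hlam : ∀ j, lam j =
      ((((f j.succ).natDegree + 1 : ℕ) : ℝ) / (((f 0).natDegree + 1 : ℕ) : ℝ) : ℝ))
    (m : Fin (s + 1) → ℤ) (ν : Fin s → ℂ)
    (hν : ∀ j, ν j = lam j * (2 * Real.pi * I * m 0 - Λ 0) - (2 * Real.pi * I * m j.succ - Λ j.succ))
    (p : Polynomial ℂ) (hp2 : 2 ≤ p.natDegree)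
    (hp : ∀ z, p.eval z = eval (Fin.cons z (fun j => lam j * z + ν j) : Fin (s + 1) → ℂ) g) :
    ∃ (z : ℕ → ℂ) (x : ℕ → Fin (s + 1) → ℂ),
      Tendsto (fun i => ‖z i‖) atTop atTop ∧
      (∀ᶠ i in atTop, ∀ j, exp (x i j) =
        eval (x i) (A j) + exp (eval (x i) g) * (f j).eval (exp (eval (x i) g))) ∧
      (∀ N : ℕ, ∀ᶠ i in atTop,
        ‖z i‖ ^ N * ‖x i - Fin.cons (z i) (fun j => lam j * z i + ν j)‖ ≤ 1) ∧
      (∀ N : ℕ, ∀ᶠ i in atTop, ‖z i‖ ^ N ≤ Real.exp (eval (x i) g).re) := by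
  classical
  -- ### constants attached to the fibres (`e₀ = 1 + deg f₀`)
  have he0pos : 0 < ((f 0).natDegree + 1 : ℕ) := Nat.succ_pos _
  have he0R : (0 : ℝ) < (((f 0).natDegree + 1 : ℕ) : ℝ) := by exact_mod_cast he0pos
  have he0R1 : (1 : ℝ) ≤ (((f 0).natDegree + 1 : ℕ) : ℝ) := by exact_mod_cast he0pos
  have he0C : (((f 0).natDegree + 1 : ℕ) : ℂ) ≠ 0 := by exact_mod_cast he0pos.ne'
  set emax : ℕ := ∑ j, ((f j).natDegree + 1) with hemax
  have hej : ∀ j, (f j).natDegree + 1 ≤ emax := fun j =>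
    Finset.single_le_sum (f := fun j => (f j).natDegree + 1) (fun j _ => Nat.zero_le _)
      (Finset.mem_univ j)
  have hemaxpos : 0 < emax := lt_of_lt_of_le (Nat.succ_pos _) (hej 0)
  have hemaxR : (0 : ℝ) < emax := by exact_mod_cast hemaxpos
  set lmin : ℝ := 1 / ((f 0).natDegree + 1 : ℕ) with hlmin
  have hlmin0 : 0 < lmin := by positivity
  have hlmin1 : lmin ≤ 1 := by rw [hlmin, div_le_one he0R]; exact he0R1
  have hlam_im : ∀ j, (lam j).im = 0 := fun j => by rw [hlam j]; exact Complex.ofReal_im _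
  have hlam_re : ∀ j, lmin ≤ (lam j).re := by
    intro j
    rw [hlam j, Complex.ofReal_re, hlmin]
    push_cast
    refine div_le_div_of_nonneg_right ?_ (by positivity)
    have : (0 : ℝ) ≤ (f j.succ).natDegree := Nat.cast_nonneg _
    linarith
  have hlam_mul : ∀ j, lam j * (((f 0).natDegree : ℂ) + 1) = ((f j.succ).natDegree : ℂ) + 1 := by
    intro j
    rw [hlam j]
    have h1 : (((f 0).natDegree : ℂ) + 1) ≠ 0 := Nat.cast_add_one_ne_zero _
    push_cast
    field_simp
  have hlam_mul' : ∀ j, lam j * (((f 0).natDegree + 1 : ℕ) : ℂ) =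
      (((f j.succ).natDegree + 1 : ℕ) : ℂ) := fun j => by push_cast; exact hlam_mul j
  set Lc : ℝ := ∑ j, |Real.log ‖(f j).leadingCoeff‖| with hLc
  have hLcj : ∀ j, |Real.log ‖(f j).leadingCoeff‖| ≤ Lc := fun j =>
    Finset.single_le_sum (f := fun j => |Real.log ‖(f j).leadingCoeff‖|) (fun j _ => abs_nonneg _)
      (Finset.mem_univ j)
  have hLc0 : 0 ≤ Lc := Finset.sum_nonneg fun j _ => abs_nonneg _
  set Bt : ℝ := ∑ j, coeffNormSum (f j).eraseLead / ‖(f j).leadingCoeff‖ with hBt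
  have hBtj : ∀ j, coeffNormSum (f j).eraseLead / ‖(f j).leadingCoeff‖ ≤ Bt := fun j =>
    Finset.single_le_sum (f := fun j => coeffNormSum (f j).eraseLead / ‖(f j).leadingCoeff‖)
      (fun j _ => div_nonneg (coeffNormSum_nonneg _) (norm_nonneg _)) (Finset.mem_univ j)
  have hBt0 : 0 ≤ Bt :=
    Finset.sum_nonneg fun j _ => div_nonneg (coeffNormSum_nonneg _) (norm_nonneg _)
  obtain ⟨BA, hBA0, NA, hBA⟩ := exists_uniform_eval_bound A
  obtain ⟨Cg, hCg0, Ng, hCg⟩ := exists_norm_eval_add_sub_eval_le g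
  have hlamn : 0 ≤ ‖lam‖ := norm_nonneg _
  have hνn : 0 ≤ ‖ν‖ := norm_nonneg _
  set Rζ : ℝ := 2 * (1 + ‖lam‖) with hRζ
  set Cx : ℝ := 3 + 3 * ‖lam‖ + ‖ν‖ with hCx
  set κ : ℝ := lmin / (4 * emax) with hκ
  have hκ0 : 0 < κ := by positivity
  set C₁ : ℝ := (lmin + ‖ν‖ + 1 + Rζ + Lc) / emax with hC₁
  set ε : ℝ := 1 / (16 * ((s : ℝ) + 2)) with hε
  have hε0 : 0 < ε := by positivity
  have hε16 : 16 * ((s : ℝ) + 2) * ε ≤ 1 :=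
    le_of_eq (mul_one_div_cancel (by positivity : (16 * ((s : ℝ) + 2)) ≠ 0))
  set D : ℕ := p.natDegree with hDdef
  set α : ℂ := p.leadingCoeff with hα
  have hp0 : p ≠ 0 := by rintro rfl; simp [hDdef] at hp2
  have hα0 : α ≠ 0 := Polynomial.leadingCoeff_ne_zero.2 hp0
  have hαpos : 0 < ‖α‖ := norm_pos_iff.2 hα0
  have hD0 : D ≠ 0 := by omega
  have hDpos : (0 : ℝ) < D := by exact_mod_cast (show 0 < D by omega)
  -- ### the escaping sign and the root lemmas
  set cc : ℂ := (2 * Real.pi * I * m 0 - Λ 0) / ((f 0).natDegree + 1 : ℕ) with hcc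
  obtain ⟨σ, hσ, hargall⟩ := exists_sign_eventually_abs_arg_le (inv_ne_zero hα0)
  obtain ⟨R₀, hR₀⟩ := exists_root_balance_of_arg p hp2 he0pos
  obtain ⟨R₁, hR₁1, hR₁⟩ := exists_derivative_lower_bound_two p hp2 he0pos
  obtain ⟨K, hK0, hK⟩ := exists_linearisation_bound_two p hp2 he0pos
  -- ### the integers `kⱼ = σ eⱼ i + mⱼ` and `Vⱼ = 2πikⱼ - Λⱼ`
  set k : ℕ → Fin (s + 1) → ℤ := fun i j => σ * ((f j).natDegree + 1 : ℕ) * i + m j with hk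
  set V : ℕ → Fin (s + 1) → ℂ := fun i j => 2 * Real.pi * I * (k i j : ℂ) - Λ j with hV
  have hΛV : ∀ i j, Λ j + V i j = 2 * Real.pi * I * (k i j : ℂ) := fun i j => by
    simp only [hV]; ring
  have hVre : ∀ i, (V i 0).re = -(Λ 0).re := fun i => by
    have h1 : (2 * Real.pi * I * (k i 0 : ℂ) : ℂ) = ((2 * Real.pi * (k i 0 : ℝ) : ℝ) : ℂ) * I := by
      push_cast; ring
    simp only [hV, Complex.sub_re, h1, Complex.re_ofReal_mul, Complex.I_re, mul_zero, zero_sub]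
  have hνV : ∀ i j, ν j = lam j * V i 0 - V i j.succ := by
    intro i j
    rw [hν j]
    simp only [hV, hk]
    push_cast
    linear_combination (-(2 * Real.pi * I * σ * (i : ℂ))) * hlam_mul j
  have hVsplit : ∀ i : ℕ, V i 0 = 2 * Real.pi * I * σ * (((f 0).natDegree + 1 : ℕ) : ℂ) * (i : ℂ) +
      (2 * Real.pi * I * m 0 - Λ 0) := fun i => by
    simp only [hV, hk]; push_cast; ring
  have hVquot : ∀ i : ℕ, V i 0 / (((f 0).natDegree + 1 : ℕ) * α) = α⁻¹ * (2 * Real.pi * I * σ * i + cc) := by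
    intro i
    rw [div_eq_iff (mul_ne_zero he0C hα0), hVsplit, hcc]
    field_simp
  set r : ℕ → ℝ := fun i => ‖(V i 0 / (((f 0).natDegree + 1 : ℕ) * α)) ^ ((D : ℂ)⁻¹)‖ with hr
  have hr0 : ∀ i, 0 ≤ r i := fun i => norm_nonneg _
  have hrD : ∀ i, r i ^ D = ‖V i 0‖ / (((f 0).natDegree + 1 : ℕ) * ‖α‖) := fun i => by
    simp only [hr]
    rw [← norm_pow, Complex.cpow_nat_inv_pow _ hD0, norm_div, norm_mul, Complex.norm_natCast]
  have hr_rpow : ∀ i, r i = (‖V i 0‖ / (((f 0).natDegree + 1 : ℕ) * ‖α‖)) ^ ((D : ℝ)⁻¹) := fun i => by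
    rw [← hrD, Real.pow_rpow_inv_natCast (hr0 i) hD0]
  set CV : ℝ := ‖(2 * Real.pi * I * m 0 - Λ 0 : ℂ)‖ with hCV
  have hVlow : ∀ i : ℕ, 2 * Real.pi * i - CV ≤ ‖V i 0‖ := fun i => by
    rw [hVsplit]; exact two_pi_mul_sub_le_norm hσ he0pos i _
  have hr_tendsto : Tendsto r atTop atTop := by
    have h1 : Tendsto (fun i : ℕ => (2 * Real.pi * i - CV) / (((f 0).natDegree + 1 : ℕ) * ‖α‖)) atTop atTop := by
      refine Tendsto.atTop_div_const (by positivity) ?_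
      have h := (tendsto_natCast_atTop_atTop (R := ℝ)).const_mul_atTop
        (by positivity : (0 : ℝ) < 2 * Real.pi)
      exact tendsto_atTop_add_const_right atTop (-CV) h
    have h2 : Tendsto (fun i : ℕ => ((2 * Real.pi * i - CV) / (((f 0).natDegree + 1 : ℕ) * ‖α‖)) ^ ((D : ℝ)⁻¹))
        atTop atTop := (tendsto_rpow_atTop (by positivity)).comp h1
    refine tendsto_atTop_mono' atTop ?_ h2
    filter_upwards [h1.eventually_ge_atTop 0] with i hi
    show _ ≤ r i
    rw [hr_rpow i]
    exact Real.rpow_le_rpow hi (div_le_div_of_nonneg_right (hVlow i) (by positivity))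
      (by positivity)
  set δ : ℕ → ℝ := fun i => Real.exp (-(κ / 2 * r i)) with hδ
  have hδpos : ∀ i, 0 < δ i := fun i => Real.exp_pos _
  set θ : ℕ → ℝ := fun i => ε * δ i / (4 * (1 + ‖lam‖)) with hθ
  have Earg : ∀ᶠ i : ℕ in atTop, |arg (V i 0 / (((f 0).natDegree + 1 : ℕ) * α))| ≤ 2 * Real.pi / 3 := by
    filter_upwards [hargall cc] with i hi
    rw [hVquot]; exact hi
  have E4 : ∀ᶠ i : ℕ in atTop, 4 ≤ r i := hr_tendsto.eventually_ge_atTop _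
  have ER₀ : ∀ᶠ i : ℕ in atTop, R₀ ≤ r i := hr_tendsto.eventually_ge_atTop _
  have ER₁ : ∀ᶠ i : ℕ in atTop, 4 / 3 * R₁ ≤ r i := hr_tendsto.eventually_ge_atTop _
  have EK : ∀ᶠ i : ℕ in atTop, 22 * K / ε + 1 ≤ r i := hr_tendsto.eventually_ge_atTop _
  have Ethr : ∀ᶠ i : ℕ in atTop, 4 * ((f 0).natDegree + 1 : ℕ) * (Rζ + Lc + ‖ν‖ + 1) + 4 ≤ r i :=
    hr_tendsto.eventually_ge_atTop _
  have Eoff : ∀ᶠ i : ℕ in atTop,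
      (((f 0).natDegree + 1 : ℕ) * Cg * (4 * (2 + ‖lam‖ + ‖ν‖)) ^ Ng) * (r i ^ Ng * Real.exp (-(κ / 2 * r i) + 0)) ≤
        ε / 16 := by
    have h := (tendsto_pow_mul_exp_neg_of_tendsto hr_tendsto (half_pos hκ0) Ng 0).const_mul
      (((f 0).natDegree + 1 : ℕ) * Cg * (4 * (2 + ‖lam‖ + ‖ν‖)) ^ Ng)
    rw [mul_zero] at h
    exact h.eventually (eventually_le_nhds (by positivity))
  have Epert : ∀ᶠ i : ℕ in atTop,
      (BA * (1 + Cx) ^ NA + Bt) * (r i ^ NA * Real.exp (-(κ / 2 * r i) + C₁)) ≤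
        ε / (4 * (1 + ‖lam‖)) := by
    have h := (tendsto_pow_mul_exp_neg_of_tendsto hr_tendsto (half_pos hκ0) NA C₁).const_mul
      (BA * (1 + Cx) ^ NA + Bt)
    rw [mul_zero] at h
    exact h.eventually (eventually_le_nhds (by positivity))
  have Eδ : ∀ᶠ i : ℕ in atTop, r i ^ 0 * Real.exp (-(κ / 2 * r i) + 0) ≤ (1 + ‖lam‖) / 4 :=
    (tendsto_pow_mul_exp_neg_of_tendsto hr_tendsto (half_pos hκ0) 0 0).eventually
      (eventually_le_nhds (by positivity))
  set good : ℕ → (Fin (s + 1) → ℂ) → Prop := fun i x =>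
    (∀ j, exp (x j) = eval x (A j) + exp (eval x g) * (f j).eval (exp (eval x g))) ∧
    ‖x - Fin.cons (x 0) (fun j => lam j * x 0 + ν j)‖ ≤ δ i ∧
    r i / 2 ≤ ‖x 0‖ ∧ ‖x 0‖ ≤ 2 * r i ∧ (r i / 4 - 3 - ‖Λ 0‖) / ((f 0).natDegree + 1 : ℕ) ≤ (eval x g).re with hgood
  have hmain : ∀ᶠ i : ℕ in atTop, ∃ x, good i x := by
    filter_upwards [Earg, E4, ER₀, ER₁, EK, Ethr, Eoff, Epert, Eδ] with i harg hr4 hR₀r hR₁r hKr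
      hthr hoffi hperti hδi
    have hr1 : 1 ≤ r i := by linarith only [hr4]
    have hrpos : 0 < r i := by linarith only [hr4]
    obtain ⟨z₀, hroot, hre0, hzup, hzlo⟩ := hR₀ (V i 0) harg hR₀r
    have hz1 : R₁ ≤ ‖z₀‖ := by linarith only [hzlo, hR₁r]
    have hz1' : 1 ≤ ‖z₀‖ := hR₁1.trans hz1
    obtain ⟨hXle, hX1⟩ := hR₁ z₀ hz1
    have hne : (1 - (((f 0).natDegree + 1 : ℕ) : ℂ) * p.derivative.eval z₀) ≠ 0 := by
      intro h; rw [h, norm_zero] at hXle; linarith only [hXle, hX1]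
    set l : ℂ := (1 - (((f 0).natDegree + 1 : ℕ) : ℂ) * p.derivative.eval z₀)⁻¹ with hl
    have hl_eq : l * (1 - (((f 0).natDegree + 1 : ℕ) : ℂ) * p.derivative.eval z₀) = 1 := inv_mul_cancel₀ hne
    have hl_norm : ‖l‖ * ‖1 - (((f 0).natDegree + 1 : ℕ) : ℂ) * p.derivative.eval z₀‖ = 1 := by
      rw [← norm_mul, hl_eq, norm_one]
    have hlX : ‖l‖ * ((((f 0).natDegree + 1 : ℕ) * D * ‖α‖ / 4) * ‖z₀‖ ^ (D - 1)) ≤ 1 := by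
      rw [← hl_norm]; exact mul_le_mul_of_nonneg_left hXle (norm_nonneg _)
    have hl1 : ‖l‖ ≤ 1 :=
      calc ‖l‖ = ‖l‖ * 1 := (mul_one _).symm
        _ ≤ ‖l‖ * ((((f 0).natDegree + 1 : ℕ) * D * ‖α‖ / 4) * ‖z₀‖ ^ (D - 1)) := mul_le_mul_of_nonneg_left hX1 (norm_nonneg _)
        _ ≤ 1 := hlX
    have hδ1 : δ i ≤ 1 := by
      show Real.exp (-(κ / 2 * r i)) ≤ 1
      exact Real.exp_le_one_iff.2 (neg_nonpos.2 (by positivity))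
    have hδle : δ i ≤ (1 + ‖lam‖) / 4 := by
      have h := hδi
      rw [pow_zero, one_mul, add_zero] at h
      exact h
    have hθ1 : θ i ≤ ε / 16 := by
      show ε * δ i / (4 * (1 + ‖lam‖)) ≤ ε / 16
      rw [div_le_iff₀ (by positivity)]
      have h := mul_le_mul_of_nonneg_left hδle hε0.le
      have h2 : ε * ((1 + ‖lam‖) / 4) = ε / 16 * (4 * (1 + ‖lam‖)) := by ring
      exact h.trans_eq h2
    have hθ2 : 4 * θ i * (1 + ‖lam‖) ≤ ε * δ i := by
      show 4 * (ε * δ i / (4 * (1 + ‖lam‖))) * (1 + ‖lam‖) ≤ ε * δ i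
      have h1 : (4 : ℝ) * (1 + ‖lam‖) ≠ 0 := by positivity
      exact le_of_eq (by field_simp)
    have hlin : ∀ t : ℂ, ‖t‖ ≤ 1 → ‖(((f 0).natDegree + 1 : ℕ) : ℂ) *
        (p.eval (z₀ + l * t) - p.eval z₀ - p.derivative.eval z₀ * (l * t))‖ ≤ ε / 16 := by
      intro t ht
      refine (hK z₀ l t hz1' ht hlX hX1).trans ?_
      have h1 : K / ‖z₀‖ ≤ K / (3 / 4 * r i) :=
        div_le_div_of_nonneg_left hK0 (by positivity) hzlo
      have h2 : K / (3 / 4 * r i) ≤ ε / 16 := by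
        rw [div_le_iff₀ (by positivity)]
        have h3 : ε / 16 * (3 / 4 * (22 * K / ε + 1)) = 33 * K / 32 + 3 * ε / 64 := by
          field_simp
          ring
        have h4 : ε / 16 * (3 / 4 * (22 * K / ε + 1)) ≤ ε / 16 * (3 / 4 * r i) := by gcongr
        have h5 : K ≤ 33 * K / 32 + 3 * ε / 64 := by
          have : 0 ≤ K / 32 + 3 * ε / 64 := by positivity
          have : 33 * K / 32 + 3 * ε / 64 = K + (K / 32 + 3 * ε / 64) := by ring
          rw [this]; exact le_add_of_nonneg_right (by positivity)
        exact h5.trans (h3.ge.trans h4)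
      exact h1.trans h2
    have hoff : ∀ ξ : Fin (s + 1) → ℂ, ‖ξ‖ ≤ 1 → ‖(((f 0).natDegree + 1 : ℕ) : ℂ) *
        (eval (Fin.cons (z₀ + l * ξ 0) (fun j => lam j * (z₀ + l * ξ 0) + ν j + (δ i) * ξ j.succ) :
            Fin (s + 1) → ℂ) g - p.eval (z₀ + l * ξ 0))‖ ≤ ε / 16 := by
      intro ξ hξ
      rw [hp (z₀ + l * ξ 0), norm_mul, Complex.norm_natCast]
      have h1 := offline_error_le g hCg0 hCg lam ν hr4 hzup hl1 (hδpos i) hδ1 ξ hξ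
      refine le_trans (mul_le_mul_of_nonneg_left h1 (Nat.cast_nonneg _)) ?_
      have h2 : (((f 0).natDegree + 1 : ℕ) : ℝ) * (Cg * (4 * (2 + ‖lam‖ + ‖ν‖)) ^ Ng * r i ^ Ng * δ i) =
          (((f 0).natDegree + 1 : ℕ) * Cg * (4 * (2 + ‖lam‖ + ‖ν‖)) ^ Ng) * (r i ^ Ng * Real.exp (-(κ / 2 * r i) + 0)) := by
        rw [hδ, add_zero]; ring
      rw [h2]
      exact hoffi
    have hthr' : Rζ + Lc ≤ lmin * (r i / 4 - 1) - ‖ν‖ - 1 := by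
      have h2 : (((f 0).natDegree + 1 : ℕ) : ℝ) * (Rζ + Lc + ‖ν‖ + 1) ≤ r i / 4 - 1 := by linarith only [hthr]
      have h3 : (((f 0).natDegree + 1 : ℕ) : ℝ) * (Rζ + Lc + ‖ν‖ + 1) / ((f 0).natDegree + 1 : ℕ) ≤ (r i / 4 - 1) / ((f 0).natDegree + 1 : ℕ) :=
        div_le_div_of_nonneg_right h2 he0R.le
      rw [mul_div_cancel_left₀ _ he0R.ne'] at h3
      have h4 : lmin * (r i / 4 - 1) = (r i / 4 - 1) / ((f 0).natDegree + 1 : ℕ) := by rw [hlmin]; ring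
      rw [h4]
      linarith only [h3]
    have hpert : ∀ j, ∀ x : Fin (s + 1) → ℂ, ‖x 0 - z₀‖ ≤ ‖l‖ →
        (∀ i' : Fin s, ‖x i'.succ - lam i' * x 0 - ν i'‖ ≤ δ i) → ∀ ζ u : ℂ, ‖ζ‖ ≤ 2 * (1 + ‖lam‖) →
        (f j).leadingCoeff * u ^ ((f j).natDegree + 1) = exp (x j - ζ) →
        ‖(eval x (A j) + u * (f j).eraseLead.eval u) * exp (ζ - x j)‖ ≤ θ i := by
      intro j x hx0 hxs ζ u hζ hcue
      have hb := perturbation_le_on_region A hBA0 hBA (f j) (hf j) (hLcj j) (hBtj j) (hej j)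
        hr4 hre0 hzup hlmin0 hlmin1 hlam_im hlam_re ν (hx0.trans hl1)
        (fun i' => (hxs i').trans hδ1) j hζ hcue hthr'
      refine hb.trans ?_
      have hexp : -((lmin * (r i / 4 - 1) - ‖ν‖ - 1 - 2 * (1 + ‖lam‖) - Lc) / emax) =
          -(κ / 2 * r i) + C₁ + -(κ / 2 * r i) := by
        rw [hκ, hC₁, hRζ]
        field_simp
        ring
      rw [hexp, Real.exp_add, ← hCx]
      have hpow : (BA * ((1 + Cx) * r i) ^ NA + Bt) ≤ (BA * (1 + Cx) ^ NA + Bt) * r i ^ NA := by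
        have h1 : Bt ≤ Bt * r i ^ NA := le_mul_of_one_le_right hBt0 (one_le_pow₀ hr1)
        calc BA * ((1 + Cx) * r i) ^ NA + Bt ≤ BA * ((1 + Cx) * r i) ^ NA + Bt * r i ^ NA :=
              add_le_add le_rfl h1
          _ = (BA * (1 + Cx) ^ NA + Bt) * r i ^ NA := by rw [mul_pow]; ring
      have hE0 : 0 ≤ Real.exp (-(κ / 2 * r i) + C₁) := (Real.exp_pos _).le
      calc (BA * ((1 + Cx) * r i) ^ NA + Bt) * (Real.exp (-(κ / 2 * r i) + C₁) * Real.exp (-(κ / 2 * r i)))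
          ≤ (BA * (1 + Cx) ^ NA + Bt) * r i ^ NA *
              (Real.exp (-(κ / 2 * r i) + C₁) * Real.exp (-(κ / 2 * r i))) :=
            mul_le_mul_of_nonneg_right hpow (by positivity)
        _ = (BA * (1 + Cx) ^ NA + Bt) * (r i ^ NA * Real.exp (-(κ / 2 * r i) + C₁)) * δ i := by
            rw [hδ]; ring
        _ ≤ ε / (4 * (1 + ‖lam‖)) * δ i := mul_le_mul_of_nonneg_right hperti (hδpos i).le
        _ = θ i := by rw [hθ]; ring
    obtain ⟨x, hxeq, hx0, hxη, ζ₀, hζ₀, hgx⟩ :=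
      exists_solution_nearLine_step g A f (Λ := Λ) (V := V i) (k := k i) hΛ (hΛV i)
        (lam := lam) (ν := ν) hlam_mul' (hνV i) (p := p) (z₀ := z₀) (l := l) (L := ‖l‖)
        (δ := δ i) (ε := ε) (θ := θ i) hroot hl_eq le_rfl (hδpos i) hδ1 hε0 hε16 hθ1 hθ2
        hlin hoff hpert
    refine ⟨x, hxeq, ?_, ?_, ?_, ?_⟩
    · refine (pi_norm_le_iff_of_nonneg (hδpos i).le).2 fun idx => ?_
      refine Fin.cases ?_ (fun j => ?_) idx
      · simp [(hδpos i).le]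
      · simp only [Pi.sub_apply, Fin.cons_succ]
        rw [← sub_sub]
        exact hxη j
    · have h1 : ‖z₀‖ - ‖x 0 - z₀‖ ≤ ‖x 0‖ := by
        have := norm_sub_norm_le z₀ (z₀ - x 0)
        rw [sub_sub_cancel, norm_sub_rev] at this
        linarith only [this]
      linarith only [h1, hx0.trans hl1, hzlo, hr4]
    · have h1 : ‖x 0‖ ≤ ‖z₀‖ + ‖x 0 - z₀‖ := by
        calc ‖x 0‖ = ‖z₀ + (x 0 - z₀)‖ := by rw [add_sub_cancel]
          _ ≤ ‖z₀‖ + ‖x 0 - z₀‖ := norm_add_le _ _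
      linarith only [h1, hx0.trans hl1, hzup, hr4]
    · have hre : (((f 0).natDegree + 1 : ℕ) : ℝ) * (eval x g).re = (x 0).re + (V i 0).re - ζ₀.re := by
        have h := congrArg Complex.re hgx
        rw [show ((((f 0).natDegree + 1 : ℕ) : ℂ) * eval x g).re = (((f 0).natDegree + 1 : ℕ) : ℝ) * (eval x g).re by
          rw [show (((f 0).natDegree + 1 : ℕ) : ℂ) = ((((f 0).natDegree + 1 : ℕ) : ℝ) : ℂ) by push_cast; rfl, Complex.re_ofReal_mul]] at h
        rw [h, Complex.sub_re, Complex.add_re]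
      have hx0re : z₀.re - 1 ≤ (x 0).re := by
        have h := Complex.abs_re_le_norm (x 0 - z₀)
        rw [Complex.sub_re] at h
        have h2 := (abs_le.1 (h.trans (hx0.trans hl1))).1
        linarith only [h2]
      have hζre : ζ₀.re ≤ 1 := (Complex.re_le_norm ζ₀).trans hζ₀
      have hΛre : -‖Λ 0‖ ≤ -(Λ 0).re := neg_le_neg (Complex.re_le_norm _)
      rw [div_le_iff₀ he0R, mul_comm]
      rw [hVre] at hre
      linarith only [hre, hx0re, hζre, hΛre, hre0]
  set xs : ℕ → Fin (s + 1) → ℂ := fun i => Classical.epsilon (good i) with hxs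
  have hxs_good : ∀ᶠ i : ℕ in atTop, good i (xs i) := by
    filter_upwards [hmain] with i hi
    exact Classical.epsilon_spec hi
  refine ⟨fun i => xs i 0, xs, ?_, ?_, fun N => ?_, fun N => ?_⟩
  · refine tendsto_atTop_mono' atTop ?_ (hr_tendsto.atTop_div_const (by norm_num : (0:ℝ) < 2))
    filter_upwards [hxs_good] with i hi
    exact hi.2.2.1
  · filter_upwards [hxs_good] with i hi
    exact hi.1
  · have h := tendsto_pow_mul_exp_neg_of_tendsto hr_tendsto (half_pos hκ0) N 0
    filter_upwards [hxs_good, h.eventually (eventually_le_nhds (by positivity : (0:ℝ) < 1 / 2 ^ N)),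
      E4] with i hi hsmall hr4
    obtain ⟨-, hdist, -, hx2, -⟩ := hi
    have hz0 : 0 ≤ ‖xs i 0‖ := norm_nonneg _
    calc ‖xs i 0‖ ^ N * ‖xs i - Fin.cons (xs i 0) (fun j => lam j * xs i 0 + ν j)‖
        ≤ (2 * r i) ^ N * δ i :=
          mul_le_mul (pow_le_pow_left₀ hz0 hx2 _) hdist (norm_nonneg _) (by positivity)
      _ = 2 ^ N * (r i ^ N * Real.exp (-(κ / 2 * r i) + 0)) := by rw [mul_pow, hδ, add_zero]; ring
      _ ≤ 2 ^ N * (1 / 2 ^ N) := mul_le_mul_of_nonneg_left hsmall (by positivity)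
      _ = 1 := mul_one_div_cancel (pow_ne_zero _ two_ne_zero)
  · have h := tendsto_pow_mul_exp_neg_of_tendsto hr_tendsto
      (by positivity : (0 : ℝ) < 1 / (4 * ((f 0).natDegree + 1 : ℕ))) N ((3 + ‖Λ 0‖) / ((f 0).natDegree + 1 : ℕ))
    filter_upwards [hxs_good, h.eventually (eventually_le_nhds (by positivity : (0:ℝ) < 1 / 2 ^ N)),
      E4] with i hi hsmall hr4
    obtain ⟨-, -, -, hx2, hreg⟩ := hi
    have hz0 : 0 ≤ ‖xs i 0‖ := norm_nonneg _
    have h1 : ‖xs i 0‖ ^ N ≤ (2 * r i) ^ N := pow_le_pow_left₀ hz0 hx2 _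
    have h2 : (2 * r i) ^ N * Real.exp (-((r i / 4 - 3 - ‖Λ 0‖) / ((f 0).natDegree + 1 : ℕ))) ≤ 1 := by
      have h3 : -((r i / 4 - 3 - ‖Λ 0‖) / ((f 0).natDegree + 1 : ℕ)) = -(1 / (4 * ((f 0).natDegree + 1 : ℕ)) * r i) + (3 + ‖Λ 0‖) / ((f 0).natDegree + 1 : ℕ) := by
        ring
      rw [h3, mul_pow]
      calc (2 : ℝ) ^ N * r i ^ N * Real.exp (-(1 / (4 * ((f 0).natDegree + 1 : ℕ)) * r i) + (3 + ‖Λ 0‖) / ((f 0).natDegree + 1 : ℕ))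
          = 2 ^ N * (r i ^ N * Real.exp (-(1 / (4 * ((f 0).natDegree + 1 : ℕ)) * r i) + (3 + ‖Λ 0‖) / ((f 0).natDegree + 1 : ℕ))) := by ring
        _ ≤ 2 ^ N * (1 / 2 ^ N) := mul_le_mul_of_nonneg_left hsmall (by positivity)
        _ = 1 := mul_one_div_cancel (pow_ne_zero _ two_ne_zero)
    have h4 : (2 * r i) ^ N ≤ Real.exp ((r i / 4 - 3 - ‖Λ 0‖) / ((f 0).natDegree + 1 : ℕ)) := by
      rw [Real.exp_neg] at h2
      rwa [mul_inv_le_iff₀ (Real.exp_pos _), one_mul] at h2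
    exact h1.trans (h4.trans (Real.exp_le_exp.2 hreg))

end Existence

end Summit.Schanuel.Schanuel.Theorems

end
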